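import Mathlib
import HarnessLib
import Summits.KontsevichZagierPeriods.KontsevichZagierPeriods.Theorems.LinRedNormalFormDihedralNormalFormStubNonSimpleReductionAux4

/-!
# Dihedral reflection of cubical atoms, V: prefix exponents of a convergent atom are non-negative

Sequel of `…StubNonSimpleReductionAux4` (crux `DihedralNormalForm`, stmt-KontsevichZagierPeriods-3912,
line `torus-descent-sum-shadow`, stub `stub_nonSimpleReduction`). The hypothesis `a' ≥ 0` of
`dihedralReflection_of_nonneg` is discharged for atoms with `q ≠ 0`: if
`α_{[0,m]} = m + Σ_{I ⊆ [0,m]} e_I < 0` for some `m`, the atom `q·xᵃ·∏(1 - x_I)^{e_I}` is NOT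
absolutely integrable on the open cube (Brown's convergence criterion, necessity, at the corner
`x₀, …, x_m → 1`): on the dyadic shells `1 - xᵢ ∈ [¾cρ, cρ]` (`i ≤ m`, `ρ = 2⁻ⁿ`, `c = 1/(2k+2)`),
`xᵢ ∈ [¼, ½]` (`i > m`) the integrand is `≥ K·ρ^{Σe}` and the shell has volume `K'·ρ^{m+1}`, so each
shell contributes `≥ K·K'` to the integral. Consequence: `dihedralReflection`, the reflection move
without the non-negativity hypothesis (for `q ≠ 0`).
-/

noncomputable section

namespace Summit.KontsevichZagierPeriods.DihedralNormalForm.TorusDescent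

open Finset Real Set MeasureTheory
open scoped ENNReal
open Literature.NumberTheory.Transcendental

variable {k : ℕ}

/-! ### Elementary estimates -/

/-- `∏ ρ^{g i} = ρ^{Σ g i}` for `ρ ≠ 0`. -/
theorem shellProd_zpow_eq_zpow_sum {ι : Type*} (s : Finset ι) {ρ : ℝ} (hρ : ρ ≠ 0) (g : ι → ℤ) :
    ∏ i ∈ s, ρ ^ g i = ρ ^ ∑ i ∈ s, g i := by
  classical
  induction s using Finset.induction_on with
  | empty => simp
  | insert a s ha ih => rw [Finset.prod_insert ha, Finset.sum_insert ha, ih, zpow_add₀ hρ]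

/-- `1 - ∏ fᵢ ≤ Σ (1 - fᵢ)` for `fᵢ ∈ [0, 1]`. -/
theorem one_sub_prod_le_sum' {ι : Type*} (s : Finset ι) {f : ι → ℝ} (h0 : ∀ i ∈ s, 0 ≤ f i)
    (h1 : ∀ i ∈ s, f i ≤ 1) : 1 - ∏ i ∈ s, f i ≤ ∑ i ∈ s, (1 - f i) := by
  classical
  induction s using Finset.induction_on with
  | empty => simp
  | insert a s ha ih =>
    rw [Finset.prod_insert ha, Finset.sum_insert ha]
    have hP0 : 0 ≤ ∏ i ∈ s, f i := Finset.prod_nonneg fun i hi => h0 i (Finset.mem_insert_of_mem hi)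
    have hP1 : ∏ i ∈ s, f i ≤ 1 := Finset.prod_le_one (fun i hi => h0 i (Finset.mem_insert_of_mem hi))
      fun i hi => h1 i (Finset.mem_insert_of_mem hi)
    have ha0 := h0 a (Finset.mem_insert_self a s)
    have ha1 := h1 a (Finset.mem_insert_self a s)
    have ih' := ih (fun i hi => h0 i (Finset.mem_insert_of_mem hi))
      (fun i hi => h1 i (Finset.mem_insert_of_mem hi))
    nlinarith [mul_nonneg ha0 (sub_nonneg.mpr hP1), mul_nonneg (sub_nonneg.mpr ha1) (sub_nonneg.mpr hP1)]

/-- A product of numbers in `[0, 1]` is at most any of its factors. -/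
theorem prod_le_factor {ι : Type*} [DecidableEq ι] (s : Finset ι) {f : ι → ℝ} (h0 : ∀ i ∈ s, 0 ≤ f i)
    (h1 : ∀ i ∈ s, f i ≤ 1) {j : ι} (hj : j ∈ s) : ∏ i ∈ s, f i ≤ f j := by
  rw [← Finset.mul_prod_erase s f hj]
  exact mul_le_of_le_one_right (h0 j hj) (Finset.prod_le_one (fun i hi => h0 i (Finset.mem_of_mem_erase hi))
    fun i hi => h1 i (Finset.mem_of_mem_erase hi))

/-- Powers on a dyadic shell: for `c'ρ ≤ t ≤ ρ`, `t^e ≥ (c'^e or 1)·ρ^e`. -/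
theorem zpow_shell_bound {t ρ c' : ℝ} (hc : 0 < c') (hρ : 0 < ρ) (ht1 : c' * ρ ≤ t) (ht2 : t ≤ ρ)
    (e : ℤ) : (if 0 ≤ e then c' ^ e.toNat else 1) * ρ ^ e ≤ t ^ e := by
  have ht : 0 < t := lt_of_lt_of_le (mul_pos hc hρ) ht1
  by_cases he : 0 ≤ e
  · obtain ⟨n, rfl⟩ := Int.eq_ofNat_of_zero_le he
    rw [if_pos he, Int.toNat_natCast, zpow_natCast, zpow_natCast, ← mul_pow]
    exact pow_le_pow_left₀ (by positivity) ht1 n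
  · rw [if_neg he, one_mul]
    have hen : e = -(e.natAbs : ℤ) := by omega
    rw [hen, zpow_neg, zpow_neg, zpow_natCast, zpow_natCast]
    exact inv_anti₀ (pow_pos ht _) (pow_le_pow_left₀ ht.le ht2 _)

/-- Powers away from the corner: for `½ ≤ t ≤ 1`, `t^e ≥ (½)^{|e|}`. -/
theorem zpow_half_bound {t : ℝ} (ht1 : 1 / 2 ≤ t) (ht2 : t ≤ 1) (e : ℤ) :
    (1 / 2 : ℝ) ^ e.natAbs ≤ t ^ e := by
  have ht : 0 < t := by linarith
  by_cases he : 0 ≤ e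
  · obtain ⟨n, rfl⟩ := Int.eq_ofNat_of_zero_le he
    rw [Int.natAbs_natCast, zpow_natCast]
    exact pow_le_pow_left₀ (by norm_num) ht1 n
  · obtain ⟨n, hn⟩ : ∃ n : ℕ, e = -(n : ℤ) := ⟨e.natAbs, by omega⟩
    subst hn
    rw [Int.natAbs_neg, Int.natAbs_natCast, zpow_neg, zpow_natCast]
    calc (1 / 2 : ℝ) ^ n ≤ 1 := pow_le_one₀ (by norm_num) (by norm_num)
      _ ≤ (t ^ n)⁻¹ := (one_le_inv₀ (pow_pos ht _)).mpr (pow_le_one₀ ht.le ht2)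

/-- The number of indices of `Fin k` of value `≤ m` is `m + 1` (`m < k`). -/
theorem card_filter_val_le {m : ℕ} (hm : m < k) :
    (Finset.univ.filter fun i : Fin k => (i : ℕ) ≤ m).card = m + 1 := by
  have : (Finset.univ.filter fun i : Fin k => (i : ℕ) ≤ m) = Finset.Iic ⟨m, hm⟩ := by
    ext i; simp [Fin.le_def]
  rw [this, Fin.card_Iic]

/-! ### The lower bound on a shell -/

/-- On the shell `1 - xᵢ ∈ [¾cρ, cρ]` (`i ≤ m`), `xᵢ ∈ [¼, ½]` (`i > m`), the `q`-free atom integrand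
is bounded below by `K · ρ^{Σ_{i ≤ j ≤ m} e i j}` with an explicit constant `K > 0`. -/
theorem atom_shell_lower_bound (a : Fin k → ℕ) (e : Fin k → Fin k → ℤ) {m : ℕ} (hm : m < k)
    {c ρ : ℝ} (hc : 0 < c) (hck : (k : ℝ) * c ≤ 1 / 2) (hρ0 : 0 < ρ) (hρ1 : ρ ≤ 1) (x : Fin k → ℝ)
    (hin : ∀ i : Fin k, (i : ℕ) ≤ m → 1 - c * ρ ≤ x i ∧ x i ≤ 1 - 3 / 4 * c * ρ)
    (hout : ∀ i : Fin k, ¬(i : ℕ) ≤ m → 1 / 4 ≤ x i ∧ x i ≤ 1 / 2) :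
    ((∏ i : Fin k, (1 / 4 : ℝ) ^ a i) *
      (∏ i : Fin k, ∏ j : Fin k, if i ≤ j ∧ (j : ℕ) ≤ m then
        (if 0 ≤ e i j then (3 / 4 * c) ^ (e i j).toNat else 1) else 1) *
      (∏ i : Fin k, ∏ j : Fin k, if i ≤ j ∧ ¬(j : ℕ) ≤ m then (1 / 2 : ℝ) ^ (e i j).natAbs else 1)) *
      ρ ^ (∑ i : Fin k, ∑ j : Fin k, if i ≤ j ∧ (j : ℕ) ≤ m then e i j else 0) ≤
    (∏ i : Fin k, x i ^ a i) * ∏ i : Fin k, ∏ j : Fin k,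
      if i ≤ j then (1 - ∏ l : Fin k, if i ≤ l ∧ l ≤ j then x l else 1) ^ e i j else 1 := by
  have hk1 : (1 : ℝ) ≤ k := by exact_mod_cast (show 1 ≤ k by omega)
  have hc1 : c * ρ ≤ 1 / 2 := by nlinarith
  have hx01 : ∀ l : Fin k, 0 ≤ x l ∧ x l ≤ 1 := by
    intro l
    by_cases hl : (l : ℕ) ≤ m
    · have := hin l hl; constructor <;> nlinarith
    · have := hout l hl; constructor <;> linarith
  have hxq : ∀ l : Fin k, 1 / 4 ≤ x l := by
    intro l
    by_cases hl : (l : ℕ) ≤ m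
    · have := hin l hl; nlinarith
    · exact (hout l hl).1
  -- monomial part
  have hM : (∏ i : Fin k, (1 / 4 : ℝ) ^ a i) ≤ ∏ i : Fin k, x i ^ a i :=
    Finset.prod_le_prod (fun i _ => by positivity) fun i _ => pow_le_pow_left₀ (by norm_num) (hxq i) _
  -- chord part, factor by factor
  have hF : ∀ i j : Fin k,
      (if i ≤ j ∧ (j : ℕ) ≤ m then (if 0 ≤ e i j then (3 / 4 * c) ^ (e i j).toNat else 1) else 1) *
        ρ ^ (if i ≤ j ∧ (j : ℕ) ≤ m then e i j else 0) *
        (if i ≤ j ∧ ¬(j : ℕ) ≤ m then (1 / 2 : ℝ) ^ (e i j).natAbs else 1) ≤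
      (if i ≤ j then (1 - ∏ l : Fin k, if i ≤ l ∧ l ≤ j then x l else 1) ^ e i j else 1) := by
    intro i j
    by_cases hij : i ≤ j
    · -- bounds on the interval product
      have hf0 : ∀ l ∈ (Finset.univ : Finset (Fin k)), 0 ≤ (if i ≤ l ∧ l ≤ j then x l else 1) :=
        fun l _ => by split_ifs; exacts [(hx01 l).1, zero_le_one]
      have hf1 : ∀ l ∈ (Finset.univ : Finset (Fin k)), (if i ≤ l ∧ l ≤ j then x l else 1) ≤ 1 :=
        fun l _ => by split_ifs; exacts [(hx01 l).2, le_rfl]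
      have hIle : (∏ l : Fin k, if i ≤ l ∧ l ≤ j then x l else 1) ≤ x j := by
        have := prod_le_factor Finset.univ hf0 hf1 (Finset.mem_univ j)
        rwa [if_pos ⟨hij, le_rfl⟩] at this
      have hI0 : 0 ≤ ∏ l : Fin k, (if i ≤ l ∧ l ≤ j then x l else 1) := Finset.prod_nonneg hf0
      rw [if_pos hij]
      by_cases hjm : (j : ℕ) ≤ m
      · have h1 : i ≤ j ∧ (j : ℕ) ≤ m := ⟨hij, hjm⟩
        have h2 : ¬(i ≤ j ∧ ¬(j : ℕ) ≤ m) := fun h => h.2 hjm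
        simp only [if_pos h1, if_neg h2, mul_one]
        -- the shell estimate
        have ht1 : 3 / 4 * c * ρ ≤ 1 - ∏ l : Fin k, (if i ≤ l ∧ l ≤ j then x l else 1) := by
          have := (hin j hjm).2; linarith
        have ht2 : 1 - (∏ l : Fin k, if i ≤ l ∧ l ≤ j then x l else 1) ≤ ρ := by
          have h1 := one_sub_prod_le_sum' Finset.univ hf0 hf1
          have h2 : (∑ l : Fin k, (1 - (if i ≤ l ∧ l ≤ j then x l else 1))) ≤ ∑ _l : Fin k, c * ρ := by
            refine Finset.sum_le_sum fun l _ => ?_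
            split_ifs with h
            · have hlm : (l : ℕ) ≤ m := le_trans (Fin.le_def.mp h.2) hjm
              have := (hin l hlm).1; linarith
            · have : 0 ≤ c * ρ := by positivity
              linarith
          rw [Finset.sum_const, Finset.card_univ, Fintype.card_fin, nsmul_eq_mul] at h2
          nlinarith
        have := zpow_shell_bound (c' := 3 / 4 * c) (by positivity) hρ0 ht1 ht2 (e i j)
        simpa [mul_comm, mul_assoc, mul_left_comm] using this
      · have h1 : ¬(i ≤ j ∧ (j : ℕ) ≤ m) := fun h => hjm h.2
        have h2 : i ≤ j ∧ ¬(j : ℕ) ≤ m := ⟨hij, hjm⟩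
        simp only [if_neg h1, if_pos h2, one_mul, zpow_zero]
        have ht1 : 1 / 2 ≤ 1 - ∏ l : Fin k, (if i ≤ l ∧ l ≤ j then x l else 1) := by
          have := (hout j hjm).2; linarith
        have ht2 : 1 - (∏ l : Fin k, if i ≤ l ∧ l ≤ j then x l else 1) ≤ 1 := by linarith
        exact zpow_half_bound ht1 ht2 (e i j)
    · have h3 : ¬(i ≤ j ∧ (j : ℕ) ≤ m) := fun h => hij h.1
      have h4 : ¬(i ≤ j ∧ ¬(j : ℕ) ≤ m) := fun h => hij h.1
      simp only [if_neg hij, if_neg h3, if_neg h4, zpow_zero, mul_one, le_refl]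
  have hF0 : ∀ i j : Fin k, 0 ≤
      (if i ≤ j ∧ (j : ℕ) ≤ m then (if 0 ≤ e i j then (3 / 4 * c) ^ (e i j).toNat else 1) else 1) *
        ρ ^ (if i ≤ j ∧ (j : ℕ) ≤ m then e i j else 0) *
        (if i ≤ j ∧ ¬(j : ℕ) ≤ m then (1 / 2 : ℝ) ^ (e i j).natAbs else 1) := by
    intro i j
    refine mul_nonneg (mul_nonneg ?_ (zpow_nonneg hρ0.le _)) ?_
    · split_ifs <;> positivity
    · split_ifs <;> positivity
  have hC : (∏ i : Fin k, ∏ j : Fin k,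
      ((if i ≤ j ∧ (j : ℕ) ≤ m then (if 0 ≤ e i j then (3 / 4 * c) ^ (e i j).toNat else 1) else 1) *
        ρ ^ (if i ≤ j ∧ (j : ℕ) ≤ m then e i j else 0) *
        (if i ≤ j ∧ ¬(j : ℕ) ≤ m then (1 / 2 : ℝ) ^ (e i j).natAbs else 1))) ≤
      ∏ i : Fin k, ∏ j : Fin k,
        (if i ≤ j then (1 - ∏ l : Fin k, if i ≤ l ∧ l ≤ j then x l else 1) ^ e i j else 1) :=
    Finset.prod_le_prod (fun i _ => Finset.prod_nonneg fun j _ => hF0 i j) fun i _ =>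
      Finset.prod_le_prod (fun j _ => hF0 i j) fun j _ => hF i j
  -- regroup the left-hand side
  have hsplit : (∏ i : Fin k, ∏ j : Fin k,
      ((if i ≤ j ∧ (j : ℕ) ≤ m then (if 0 ≤ e i j then (3 / 4 * c) ^ (e i j).toNat else 1) else 1) *
        ρ ^ (if i ≤ j ∧ (j : ℕ) ≤ m then e i j else 0) *
        (if i ≤ j ∧ ¬(j : ℕ) ≤ m then (1 / 2 : ℝ) ^ (e i j).natAbs else 1))) =
      (∏ i : Fin k, ∏ j : Fin k, if i ≤ j ∧ (j : ℕ) ≤ m then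
        (if 0 ≤ e i j then (3 / 4 * c) ^ (e i j).toNat else 1) else 1) *
      ρ ^ (∑ i : Fin k, ∑ j : Fin k, if i ≤ j ∧ (j : ℕ) ≤ m then e i j else 0) *
      (∏ i : Fin k, ∏ j : Fin k, if i ≤ j ∧ ¬(j : ℕ) ≤ m then (1 / 2 : ℝ) ^ (e i j).natAbs else 1) := by
    simp only [Finset.prod_mul_distrib]
    congr 2
    rw [← shellProd_zpow_eq_zpow_sum _ hρ0.ne']
    exact Finset.prod_congr rfl fun i _ => shellProd_zpow_eq_zpow_sum _ hρ0.ne' _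
  rw [hsplit] at hC
  have hM0 : 0 ≤ ∏ i : Fin k, (1 / 4 : ℝ) ^ a i := Finset.prod_nonneg fun i _ => by positivity
  have hL0 : 0 ≤ (∏ i : Fin k, ∏ j : Fin k, if i ≤ j ∧ (j : ℕ) ≤ m then
        (if 0 ≤ e i j then (3 / 4 * c) ^ (e i j).toNat else 1) else 1) *
      ρ ^ (∑ i : Fin k, ∑ j : Fin k, if i ≤ j ∧ (j : ℕ) ≤ m then e i j else 0) *
      (∏ i : Fin k, ∏ j : Fin k, if i ≤ j ∧ ¬(j : ℕ) ≤ m then (1 / 2 : ℝ) ^ (e i j).natAbs else 1) := by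
    refine mul_nonneg (mul_nonneg ?_ (zpow_nonneg hρ0.le _)) ?_
    · exact Finset.prod_nonneg fun i _ => Finset.prod_nonneg fun j _ => by split_ifs <;> positivity
    · exact Finset.prod_nonneg fun i _ => Finset.prod_nonneg fun j _ => by split_ifs <;> positivity
  have hprod := mul_le_mul hM hC hL0 (le_trans hM0 hM)
  calc _ = (∏ i : Fin k, (1 / 4 : ℝ) ^ a i) * ((∏ i : Fin k, ∏ j : Fin k, if i ≤ j ∧ (j : ℕ) ≤ m then
        (if 0 ≤ e i j then (3 / 4 * c) ^ (e i j).toNat else 1) else 1) *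
      ρ ^ (∑ i : Fin k, ∑ j : Fin k, if i ≤ j ∧ (j : ℕ) ≤ m then e i j else 0) *
      (∏ i : Fin k, ∏ j : Fin k, if i ≤ j ∧ ¬(j : ℕ) ≤ m then (1 / 2 : ℝ) ^ (e i j).natAbs else 1)) := by
        ring
    _ ≤ _ := hprod


/-! ### Non-negativity of the prefix exponents -/

/-- **Prefix exponents of a convergent atom are non-negative** (necessity in Brown's convergence
criterion at the corners `x₀ = ⋯ = x_m = 1`): if `[□ᵏ, q·xᵃ·∏(1 - x_I)^{e_I}]` with `q ≠ 0` is an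
integral representation (absolutely convergent), then `(k-1-l) + Σ_{I ⊆ [0,k-1-l]} e_I ≥ 0` for every
`l`. These are the monomial exponents `a'` of the reflected atom of `dihedralReflection_of_nonneg`. -/
theorem prefix_exponent_nonneg : ∀ (k : ℕ) (q : ℚ) (a : Fin k → ℕ) (e : Fin k → Fin k → ℤ) (s : Literature.NumberTheory.Transcendental.KZ.IntegralRep k), q ≠ 0 → s.domain = {x : Fin k → ℝ | ∀ i, x i ∈ Set.Ioo (0:ℝ) 1} → Set.EqOn s.integrand (fun x => (q : ℝ) * ((∏ i : Fin k, x i ^ a i) * ∏ i : Fin k, ∏ j : Fin k, if i ≤ j then (1 - (∏ l : Fin k, if i ≤ l ∧ l ≤ j then x l else 1)) ^ e i j else 1)) s.domain → ∀ l : Fin k, (0 : ℤ) ≤ ((k : ℤ) - 1 - (l : ℕ)) + ∑ i' : Fin k, ∑ j' : Fin k, if i' ≤ j' ∧ (j' : ℕ) + (l : ℕ) + 1 ≤ k then e i' j' else 0 := by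
  intro k q a e s hq hdom hint l
  by_contra hneg
  push Not at hneg
  have hlk := l.isLt
  set m : ℕ := k - 1 - (l : ℕ) with hm_def
  have hmk : m < k := by omega
  have hmz : ((k : ℤ) - 1 - (l : ℕ)) = (m : ℤ) := by omega
  -- the exponent sum in terms of `m`
  have hS : (∑ i' : Fin k, ∑ j' : Fin k, if i' ≤ j' ∧ (j' : ℕ) + (l : ℕ) + 1 ≤ k then e i' j' else 0) =
      ∑ i' : Fin k, ∑ j' : Fin k, if i' ≤ j' ∧ (j' : ℕ) ≤ m then e i' j' else 0 := by
    refine Finset.sum_congr rfl fun i' _ => Finset.sum_congr rfl fun j' _ => ?_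
    have : (i' ≤ j' ∧ (j' : ℕ) + (l : ℕ) + 1 ≤ k) ↔ (i' ≤ j' ∧ (j' : ℕ) ≤ m) := by
      constructor <;> rintro ⟨h1, h2⟩ <;> exact ⟨h1, by omega⟩
    rw [if_congr this rfl rfl]
  rw [hmz, hS] at hneg
  set S : ℤ := ∑ i' : Fin k, ∑ j' : Fin k, if i' ≤ j' ∧ (j' : ℕ) ≤ m then e i' j' else 0 with hS_def
  have hSm : S + m + 1 ≤ 0 := by linarith
  -- constants and shells
  set c : ℝ := 1 / (2 * (k : ℝ) + 2) with hc_def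
  have hk1 : (1 : ℝ) ≤ k := by exact_mod_cast (show 1 ≤ k by omega)
  have hc : 0 < c := by rw [hc_def]; positivity
  have hck : (k : ℝ) * c ≤ 1 / 2 := by
    rw [hc_def, mul_one_div, div_le_iff₀ (by positivity)]; nlinarith
  have hc4 : c ≤ 1 / 4 := by
    rw [hc_def, div_le_iff₀ (by positivity)]; nlinarith
  let ρ : ℕ → ℝ := fun n => (1 / 2 : ℝ) ^ n
  have hρ0 : ∀ n, 0 < ρ n := fun n => by positivity
  have hρ1 : ∀ n, ρ n ≤ 1 := fun n => pow_le_one₀ (by norm_num) (by norm_num)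
  have hρsucc : ∀ n n', n < n' → ρ n' ≤ ρ n / 2 := by
    intro n n' h
    have : ρ n' ≤ ρ (n + 1) := pow_le_pow_of_le_one (by norm_num) (by norm_num) h
    calc ρ n' ≤ ρ (n + 1) := this
      _ = ρ n / 2 := by simp only [ρ, pow_succ]; ring
  let lo : ℕ → Fin k → ℝ := fun n i => if (i : ℕ) ≤ m then 1 - c * ρ n else 1 / 4
  let hi : ℕ → Fin k → ℝ := fun n i => if (i : ℕ) ≤ m then 1 - 3 / 4 * c * ρ n else 1 / 2
  let B : ℕ → Set (Fin k → ℝ) := fun n => Set.Icc (lo n) (hi n)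
  have hBmem : ∀ n x, x ∈ B n ↔ ∀ i, lo n i ≤ x i ∧ x i ≤ hi n i := fun n x => by
    simp only [B, Set.mem_Icc, Pi.le_def]; exact ⟨fun h i => ⟨h.1 i, h.2 i⟩, fun h => ⟨fun i => (h i).1, fun i => (h i).2⟩⟩
  have hBin : ∀ n x, x ∈ B n → ∀ i : Fin k, (i : ℕ) ≤ m → 1 - c * ρ n ≤ x i ∧ x i ≤ 1 - 3 / 4 * c * ρ n := by
    intro n x hx i hi'
    have := (hBmem n x).mp hx i
    simp only [lo, hi, if_pos hi'] at this
    exact this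
  have hBout : ∀ n x, x ∈ B n → ∀ i : Fin k, ¬(i : ℕ) ≤ m → 1 / 4 ≤ x i ∧ x i ≤ 1 / 2 := by
    intro n x hx i hi'
    have := (hBmem n x).mp hx i
    simp only [lo, hi, if_neg hi'] at this
    exact this
  -- (1) the shells lie in the open cube
  have hBsub : ∀ n, B n ⊆ s.domain := by
    intro n x hx
    rw [hdom]
    intro i
    by_cases hi' : (i : ℕ) ≤ m
    · have h := hBin n x hx i hi'
      have : c * ρ n ≤ 1 / 4 := by nlinarith [hρ1 n, hρ0 n]
      constructor <;> nlinarith [hρ0 n]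
    · have h := hBout n x hx i hi'
      constructor <;> linarith
  -- (2) measurability and (3) disjointness
  have hBmeas : ∀ n, MeasurableSet (B n) := fun n => measurableSet_Icc
  have hk0 : 0 < k := by omega
  have hBdisj : Pairwise (Function.onFun Disjoint B) := by
    intro n n' hne
    rw [Function.onFun, Set.disjoint_left]
    intro x hx hx'
    have h0 := hBin n x hx ⟨0, hk0⟩ (Nat.zero_le _)
    have h0' := hBin n' x hx' ⟨0, hk0⟩ (Nat.zero_le _)
    rcases lt_or_gt_of_ne hne with h | h
    · have := hρsucc n n' h; nlinarith [hρ0 n, hρ0 n']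
    · have := hρsucc n' n h; nlinarith [hρ0 n, hρ0 n']
  -- (4) the volume of a shell
  have hvol : ∀ n, volume (B n) = ENNReal.ofReal ((1 / 4 : ℝ) ^ k * (c * ρ n) ^ (m + 1)) := by
    intro n
    have hdiff : ∀ i : Fin k, hi n i - lo n i = (1 / 4 : ℝ) * (if (i : ℕ) ≤ m then c * ρ n else 1) := by
      intro i; simp only [hi, lo]; split_ifs <;> ring
    simp only [B]
    rw [Real.volume_Icc_pi]
    simp_rw [hdiff]
    rw [← ENNReal.ofReal_prod_of_nonneg (fun i _ => by positivity)]
    congr 1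
    rw [Finset.prod_mul_distrib, Finset.prod_const, Finset.card_univ, Fintype.card_fin,
      Finset.prod_ite, Finset.prod_const_one, mul_one, Finset.prod_const, card_filter_val_le hmk]
  -- (5) the lower bound of the integrand on a shell
  set K : ℝ := (∏ i : Fin k, (1 / 4 : ℝ) ^ a i) *
      (∏ i : Fin k, ∏ j : Fin k, if i ≤ j ∧ (j : ℕ) ≤ m then
        (if 0 ≤ e i j then (3 / 4 * c) ^ (e i j).toNat else 1) else 1) *
      (∏ i : Fin k, ∏ j : Fin k, if i ≤ j ∧ ¬(j : ℕ) ≤ m then (1 / 2 : ℝ) ^ (e i j).natAbs else 1)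
    with hK_def
  have hK : 0 < K := by
    refine mul_pos (mul_pos (Finset.prod_pos fun i _ => by positivity)
      (Finset.prod_pos fun i _ => Finset.prod_pos fun j _ => ?_))
      (Finset.prod_pos fun i _ => Finset.prod_pos fun j _ => ?_)
    · split_ifs <;> positivity
    · split_ifs <;> positivity
  have hlow : ∀ n, ∀ x ∈ B n, ENNReal.ofReal (|(q : ℝ)| * K * ρ n ^ S) ≤ ‖s.integrand x‖ₑ := by
    intro n x hx
    have hxdom : x ∈ s.domain := hBsub n hx
    rw [hint hxdom, Real.enorm_eq_ofReal_abs]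
    refine ENNReal.ofReal_le_ofReal ?_
    have hb := atom_shell_lower_bound a e hmk hc hck (hρ0 n) (hρ1 n) x (hBin n x hx) (hBout n x hx)
    rw [abs_mul]
    have hA0 : 0 ≤ (∏ i : Fin k, x i ^ a i) * ∏ i : Fin k, ∏ j : Fin k,
        (if i ≤ j then (1 - ∏ l : Fin k, if i ≤ l ∧ l ≤ j then x l else 1) ^ e i j else 1) :=
      le_trans (mul_nonneg hK.le (zpow_nonneg (hρ0 n).le _)) hb
    rw [abs_of_nonneg hA0, mul_assoc]
    exact mul_le_mul_of_nonneg_left hb (abs_nonneg _)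
  -- (6) each shell contributes at least `δ`
  set δ : ℝ≥0∞ := ENNReal.ofReal (|(q : ℝ)| * K * ((1 / 4 : ℝ) ^ k * c ^ (m + 1))) with hδ_def
  have hδ : δ ≠ 0 := by
    rw [hδ_def]
    exact (ENNReal.ofReal_pos.mpr (by positivity)).ne'
  have hshell : ∀ n, δ ≤ ∫⁻ x in B n, ‖s.integrand x‖ₑ := by
    intro n
    calc δ ≤ ENNReal.ofReal (|(q : ℝ)| * K * ρ n ^ S) * volume (B n) := by
          rw [hvol n, ← ENNReal.ofReal_mul (by positivity), hδ_def]
          refine ENNReal.ofReal_le_ofReal ?_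
          have hρS : 1 ≤ ρ n ^ S * ρ n ^ ((m : ℤ) + 1) := by
            rw [← zpow_add₀ (hρ0 n).ne']
            obtain ⟨w, hw⟩ : ∃ w : ℕ, S + ((m : ℤ) + 1) = -(w : ℤ) := ⟨(-(S + m + 1)).toNat, by omega⟩
            rw [hw, zpow_neg, zpow_natCast]
            exact (one_le_inv₀ (pow_pos (hρ0 n) _)).mpr (pow_le_one₀ (hρ0 n).le (hρ1 n))
          have hpow : (c * ρ n) ^ (m + 1) = c ^ (m + 1) * ρ n ^ ((m : ℤ) + 1) := by
            rw [mul_pow, ← zpow_natCast]; norm_cast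
          rw [hpow]
          have h1 : 0 ≤ |(q : ℝ)| * K * ((1 / 4 : ℝ) ^ k * c ^ (m + 1)) := by positivity
          calc |(q : ℝ)| * K * ((1 / 4 : ℝ) ^ k * c ^ (m + 1))
              = |(q : ℝ)| * K * ((1 / 4 : ℝ) ^ k * c ^ (m + 1)) * 1 := by ring
            _ ≤ |(q : ℝ)| * K * ((1 / 4 : ℝ) ^ k * c ^ (m + 1)) * (ρ n ^ S * ρ n ^ ((m : ℤ) + 1)) :=
                mul_le_mul_of_nonneg_left hρS h1
            _ = |(q : ℝ)| * K * ρ n ^ S * ((1 / 4 : ℝ) ^ k * (c ^ (m + 1) * ρ n ^ ((m : ℤ) + 1))) := by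
                ring
      _ = ∫⁻ _ in B n, ENNReal.ofReal (|(q : ℝ)| * K * ρ n ^ S) := (setLIntegral_const _ _).symm
      _ ≤ ∫⁻ x in B n, ‖s.integrand x‖ₑ := setLIntegral_mono' (hBmeas n) (hlow n)
  -- (7) summing over the shells contradicts absolute convergence
  have hfin : ∫⁻ x in s.domain, ‖s.integrand x‖ₑ < ⊤ := s.integrableOn.2
  have hU : (⋃ n, B n) ⊆ s.domain := Set.iUnion_subset hBsub
  have htop : ∫⁻ x in ⋃ n, B n, ‖s.integrand x‖ₑ = ⊤ := by
    rw [lintegral_iUnion hBmeas hBdisj]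
    refine eq_top_iff.mpr ?_
    calc (⊤ : ℝ≥0∞) = ∑' _ : ℕ, δ := (ENNReal.tsum_const_eq_top_of_ne_zero hδ).symm
      _ ≤ ∑' n, ∫⁻ x in B n, ‖s.integrand x‖ₑ := ENNReal.tsum_le_tsum hshell
  have := lintegral_mono_set (μ := volume) (f := fun x => ‖s.integrand x‖ₑ) hU
  rw [htop] at this
  exact absurd (le_antisymm le_top this ▸ hfin) (lt_irrefl _)


/-- **Dihedral reflection of cubical atoms** (unconditional form for `q ≠ 0`): the reflection
`S = C⁻¹ ∘ (t ↦ 𝟙 - t^{rev}) ∘ C` of Brown's polygon, read in the cubical chart, is a KZ relation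
between the atom `[□ᵏ, q·xᵃ·∏_{i≤j}(1 - x_i⋯x_j)^{e i j}]` and the atom with the reflected exponents
(`dihedralReflection_of_nonneg` + `prefix_exponent_nonneg`). Together with the coordinate reversal
(`KZ.permRel`) it generates the dihedral group `D_{k+3}` acting on cubical atoms. -/
theorem dihedralReflection : ∀ (k : ℕ) (q : ℚ) (a : Fin k → ℕ) (e : Fin k → Fin k → ℤ) (s : Literature.NumberTheory.Transcendental.KZ.IntegralRep k), q ≠ 0 → s.domain = {x : Fin k → ℝ | ∀ i, x i ∈ Set.Ioo (0:ℝ) 1} → Set.EqOn s.integrand (fun x => (q : ℝ) * ((∏ i : Fin k, x i ^ a i) * ∏ i : Fin k, ∏ j : Fin k, if i ≤ j then (1 - (∏ l : Fin k, if i ≤ l ∧ l ≤ j then x l else 1)) ^ e i j else 1)) s.domain → ∃ (a' : Fin k → ℕ) (s' : Literature.NumberTheory.Transcendental.KZ.IntegralRep k), (∀ l : Fin k, ((a' l : ℕ) : ℤ) = ((k : ℤ) - 1 - (l : ℕ)) + ∑ i' : Fin k, ∑ j' : Fin k, if i' ≤ j' ∧ (j' : ℕ) + (l : ℕ) + 1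 ≤ k then e i' j' else 0) ∧ s'.domain = {x : Fin k → ℝ | ∀ i, x i ∈ Set.Ioo (0:ℝ) 1} ∧ Set.EqOn s'.integrand (fun x => (q : ℝ) * ((∏ i : Fin k, x i ^ a' i) * ∏ i : Fin k, ∏ j : Fin k, if i ≤ j then (1 - (∏ l : Fin k, if i ≤ l ∧ l ≤ j then x l else 1)) ^ (if (i : ℕ) = 0 then ((∑ l : Fin k, if (l : ℕ) + 1 + (j : ℕ) = k then (a l : ℤ) else 0) - (∑ l : Fin k, if (l : ℕ) + (j : ℕ) = k then (a l : ℤ) + 1 else 0) - ∑ i' : Fin k, ∑ j' : Fin k, if (i' : ℕ) + (j : ℕ) = k ∧ i' ≤ j' then e i' j' else 0) else ∑ i' : Fin k, ∑ j' : Fin k, if (i' : ℕ) + (j : ℕ) = k ∧ (j' : ℕ) + (i : ℕ) = k then e i' j' else 0) else 1)) s'.domain ∧ Literature.NumberTheory.Transcendental.KZ.of s - Literature.NumberTheory.Transcendental.KZ.of s' ∈ Literature.NumberTheory.Transcendental.KZ.relations :=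
  fun k q a e s hq hdom hint =>
    dihedralReflection_of_nonneg k q a e s hdom hint (prefix_exponent_nonneg k q a e s hq hdom hint)

end Summit.KontsevichZagierPeriods.DihedralNormalForm.TorusDescent
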